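import Summits.BirchSwinnertonDyer.BirchSwinnertonDyer.Theorems.KolyvaginDepthDoorDepthTableSteinWuthrichRows9
import Summits.BirchSwinnertonDyer.BirchSwinnertonDyer.Theorems.KolyvaginDepthDoorDepthTableRowsRankThreeNoTwist2
import HarnessLib

/-!
# Route `KolyvaginDepthDoor`, crux `KolyvaginDepthSupplyKN` (stmt-BirchSwinnertonDyer-22820) —
# DEPTH TABLE v14: THE ODD-RANK ROW `16811a1` (rank `3`, `N = 16811`) in the v13 / exact currency —
# `Ш(E)[5] = 0` BY NAME (Stein–Wuthrich 2013 Thm. 1.1), the exact reading «body ⟺ twist condition»,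
# the depth row «bit ⟺ one twist-Selmer bound», and the crux's clause modulo ONE bound on a twist of EVEN analytic rank

Helper file of the lead prover of line `levelone` (kdd-p1 g18; `--supports stmt-BirchSwinnertonDyer-22820
--as helper`); it closes nothing and BSD is NOT proved by it.

Companion of `KolyvaginDepthDoorDepthTableSteinWuthrichRankThree` (`5077a1`, the generic rank-zero currency
lemma `cruxBody_of_twistSelmer_trivial_of_steinWuthrich`, framing). The nine kernel-certified RANK-THREE atlas
curves (g6–g8 rows in the door direction, `…RowsRankThreeNoTwist2…5`) were never read in the lineage's exact /
v13 currency; all lie in the Stein–Wuthrich range (`N ≤ 22 696 ≤ 30 000`, semistable, `5` good ordinary,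
`ρ̄_{E,5}` onto, non-CM, `3 ≤ rank` in the kernel). This file: `16811a1` = `[0,0,1,-1,6]`,
`|Δ| = 16811`, at `(p, d_K) = (5, -7)` (kernel certificates `intModel`, `hasSurjectiveModNGaloisRep_pow_5`,
`not_hasCM`, `heegner_neg7`, `three_le_rank` from `KolyvaginDepthDoorDepthTableRowsRankThreeNoTwist2`; NEW: `card_5` / `goodOrdinary_5` (`a_5 = -2`),
`conductorNorm_eq` (semistable, `N = rad Δ = 16811`), `spade_5` (♠ at `5`)):

* `sha_inf_torsionBy_five_eq_bot` — `Ш(E/ℚ)[5] = 0` BY NAME (SW Thm. 1.1 at the kernel certificates).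
* `exactBody_5_neg7_iff_twistCondition` — the crux's `∃`-body at `(E, 5, K)` `↔` the twist condition
  `TC(E, 5, K)` ALONE (g14's exact reading on the ♠ cell, `E`-side discharged): the crux's content at this curve
  is a statement about ONE quadratic twist of EVEN analytic rank.
* `exactRowDepth_5_neg7_iff_twistSelmer` — the row at depth `rank − 1`: bit `↔` `#Sel_5(E^{(d_K)}) ≤ 5^{rank−1}`.
* `cruxBody_of_twistSelmer` — the CLAUSE of the crux at `16811a1` VERBATIM from ONE bound `#Sel_5(E^{(d_K)}/ℚ) ≤ 5³`
  (engine: g17's `cruxBody_of_twistSelmer_of_steinWuthrich`, `5³ ≤ 5^rank`). Numerically (context only) `L(E^{(−7)}, 1) ≈ 5.25 ≠ 0`: the rank-zero currency applies at this field.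

At odd rank the Heegner twist has EVEN analytic rank: where `L(E^{(d_K)}, 1) ≠ 0` the closing datum is
`Sel_5(E^{(d_K)}/ℚ) = 0` — the `5`-part of BSD of a RANK-ZERO curve (no Heegner point of infinite order, no
`p`-adic height), cheaper than the rank-one datum of every even-rank row (`CLOSING-DATA-v13.md`).
CONDITIONAL on (γ) = Gross 1991 Prop. 3.7 (2) (iff rows only), W. Zhang 2014 Lemma 8.4 (1) / Thm. 9.1 and
Stein–Wuthrich 2013 Thm. 1.1, BY NAME; per curve; nothing class-wide (the open stub (S♭) is untouched); BSD
is NOT proved by any of this.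

References: [SteinWuthrich2013] Thm. 1.1 (p. 1758), §12.4; [WZhang2014] Lemma 8.4 (1) (p. 236), Thm. 9.1
(p. 240), Hypothesis ♠ (pp. 194–195); [GrossLMS1991] Prop. 3.7 (2); [CremonaAlgorithms1997] Table 1 (16811a1);
[Silverman1994] IV.10.2; [SilvermanAEC2009] VII.5.1, X.4.2.
-/

set_option linter.dupNamespace false

noncomputable section

open scoped Classical NumberField

namespace Summit.BirchSwinnertonDyer.BirchSwinnertonDyer.Theorems.KolyvaginDepthDoor

open Literature.NumberTheory.EllipticCurves Literature.NumberTheory.EllipticCurves.ModularForms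
  WeierstrassCurve NumberField IsDedekindDomain
open Summit.BirchSwinnertonDyer.BirchSwinnertonDyer.Theorems
open Summit.BirchSwinnertonDyer.BirchSwinnertonDyer.Rank2Observatory
open Summit.BirchSwinnertonDyer.BirchSwinnertonDyer.Rank1Residual
open Summit.BirchSwinnertonDyer.Rank1Residual.Additive

/-! ## `16811a1` (`[0,0,1,-1,6]`, `N = 16811`, `|Δ| = 16811`, rank `3`) at `(p, d_K) = (5, -7)` -/

namespace C16811a1

/-- `#Ẽ(𝔽₅)(16811a1) = 8`, i.e. `a_5 = -2` (kernel-decided by the `ℕ`-arithmetic Euler count).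
[cite: CremonaAlgorithms1997, Table 1 (16811a1)] -/
theorem card_5 :
    Nat.card (((⟨0, 0, 1, -1, 6⟩ : WeierstrassCurve ℤ).map (Int.castRingHom (ZMod 5))).toAffine.Point) =
      8 := by
  rw [PointCountNat.natCard_point_map_eq (hℓ := ⟨by norm_num⟩) (by norm_num) 0 0 1 (-1) 6
    (by decide +kernel)]
  decide +kernel

/-- **`5` is a prime of good ORDINARY reduction for `16811a1`** (`5 ∤ Δ`, `a_5 = -2 ≢ 0 (mod 5)`).
[cite: CremonaAlgorithms1997, Table 1 (16811a1)] [cite: SilvermanAEC2009, VII.5 Prop. 5.1 (a)] -/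
theorem goodOrdinary_5 :
    haveI := isGloballyMinimal_of_mem_atlasR3A00 mem_atlas;
    haveI := Fact.mk (by norm_num : Nat.Prime 5);
    (c16811a1.e.baseChange ℚ).HasGoodReductionAtPrime 5 ∧
      ¬ ((5 : ℕ) : ℤ) ∣ (c16811a1.e.baseChange ℚ).frobeniusTrace 5 := by
  haveI := isGloballyMinimal_of_mem_atlasR3A00 mem_atlas
  haveI := Fact.mk (by norm_num : Nat.Prime 5)
  exact goodOrdinary_of_intModel_certificate intModel 5 (by decide +kernel) (n := 8) card_5
    (by decide +kernel)

/-- **`N(16811a1) = 16811`** (semistable: `gcd(Δ, c₄) = 1` with `c₄ = 48`, `|Δ| = 16811`, `N = rad Δ`;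
Silverman ATAEC IV.10.2). [cite: CremonaAlgorithms1997, Table 1 (16811a1)] [cite: Silverman1994, IV.10.2 (a),(b)] -/
theorem conductorNorm_eq :
    haveI := isElliptic_of_mem_atlasR3A00 mem_atlas;
    (c16811a1.e.baseChange ℚ).conductorNorm ℤ = 16811 := by
  haveI := isElliptic_of_mem_atlasR3A00 mem_atlas
  haveI := isGloballyMinimal_of_mem_atlasR3A00 mem_atlas
  have h : c16811a1.e.baseChange ℚ = (⟨0, 0, 1, -1, 6⟩ : WeierstrassCurve ℤ).baseChange ℚ :=
    eq_baseChange_of_intModel intModel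
  haveI : ((⟨0, 0, 1, -1, 6⟩ : WeierstrassCurve ℤ).baseChange ℚ).IsElliptic := by rw [← h]; infer_instance
  rw [h]
  refine BurungaleSkinner2023.conductorNorm_baseChange_int_of_isCoprime _
    (by rw [Int.isCoprime_iff_gcd_eq_one]; decide +kernel) (k := 1) ?_ (by decide +kernel)
    (by decide +kernel)
  rw [Nat.squarefree_iff_nodup_primeFactorsList (by norm_num)]; simp

/-- **♠ for `16811a1` at `p = 5`:** `|Δ_min| = 16811` (exponents prime to `5`) ⇒ `5 ∤ v_ℓ(Δ_min)` at every
multiplicative `ℓ`; `gcd(c₄, Δ) = 1` ⇒ semistable over `ℤ`. [cite: WZhang2014, Hypothesis ♠ (pp. 194–195)]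
[cite: CremonaAlgorithms1997, Table 1 (16811a1)] -/
theorem spade_5 :
    haveI := isElliptic_of_mem_atlasR3A00 mem_atlas;
    haveI := isGloballyMinimal_of_mem_atlasR3A00 mem_atlas;
    (∀ (ℓ : ℕ) [Fact ℓ.Prime], (c16811a1.e.baseChange ℚ).HasMultiplicativeReductionAtPrime ℓ →
      ¬ 5 ∣ padicValInt ℓ (c16811a1.e.baseChange ℚ).minimalDiscriminantInt) ∧
      (c16811a1.e.baseChange ℚ).IsSemistable ℤ := by
  haveI := isElliptic_of_mem_atlasR3A00 mem_atlas
  haveI := isGloballyMinimal_of_mem_atlasR3A00 mem_atlas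
  haveI := Fact.mk (by norm_num : Nat.Prime 5)
  exact ⟨not_dvd_padicValInt_of_intModel intModel 5
      (forall_prime_dvd_of_natAbs_eq_pow (a := 16811) (i := 1) (by decide +kernel) (by norm_num)
        ⟨1, by decide +kernel, by decide +kernel, by norm_num⟩),
    isSemistable_int_of_intModel_of_isCoprime intModel
      (by rw [Int.isCoprime_iff_gcd_eq_one]; decide +kernel)⟩

/-- **`Ш(16811a1/ℚ)[5] = 0` BY NAME** — Stein–Wuthrich 2013 Thm. 1.1 at the kernel certificates: non-CM
`not_hasCM`, `2 ≤ 3 ≤ rank` `three_le_rank`, `N = 16811 ≤ 30 000` `conductorNorm_eq`, `5` good ordinary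
`goodOrdinary_5`, `ρ̄_{E,5}` onto `hasSurjectiveModNGaloisRep_pow_5 1`. CONDITIONAL on that named fact; per curve;
BSD is not proved by it. [cite: SteinWuthrich2013, Thm. 1.1 (p. 1758)] [cite: CremonaAlgorithms1997, Table 1 (16811a1)] -/
theorem sha_inf_torsionBy_five_eq_bot (hSW : SteinWuthrich2013_sha_inf_torsionBy_eq_bot_of_two_le_rank) :
    haveI := isElliptic_of_mem_atlasR3A00 mem_atlas;
    haveI := Fact.mk (by norm_num : Nat.Prime 5);
    ((c16811a1.e.baseChange ℚ).sha ⊓ AddSubgroup.torsionBy (c16811a1.e.baseChange ℚ).galH1 ((5 : ℕ) : ℤ) :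
      AddSubgroup _) = ⊥ := by
  haveI := isElliptic_of_mem_atlasR3A00 mem_atlas
  haveI := isGloballyMinimal_of_mem_atlasR3A00 mem_atlas
  haveI := Fact.mk (by norm_num : Nat.Prime 5)
  have hsur : (c16811a1.e.baseChange ℚ).HasSurjectiveModNGaloisRep (5 ^ 1 : ℕ) :=
    hasSurjectiveModNGaloisRep_pow_5 1
  rw [pow_one] at hsur
  exact hSW _ not_hasCM (le_trans (by norm_num) three_le_rank) (by rw [conductorNorm_eq]; norm_num) 5
    (by norm_num) (by norm_num) goodOrdinary_5.1 goodOrdinary_5.2 hsur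

/-- **THE CRUX `KolyvaginDepthSupplyKN` AT THE RANK-THREE CURVE `16811a1`, MODULO ONE TWIST `5`-SELMER
BOUND.** Granted the two named print facts (Stein–Wuthrich 2013 Thm. 1.1; W. Zhang 2014 Lemma 8.4 (1) /
Thm. 9.1) and, for ONE imaginary quadratic `K` with `d_K = -7`, the bound `#Sel_5(E^{(d_K)}/ℚ) ≤ 5³` on the
Heegner twist, the CLAUSE of the crux holds at `W = 16811a1` VERBATIM: witnesses `p = 5` (good ordinary
`goodOrdinary_5`, `ρ_{E,5^∞}` onto `hasSurjectiveModNGaloisRep_pow_5`, Kodaira–Néron and ♠ from `|Δ(E₀)| = 16811`),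
that `K` (Heegner `heegner_neg7`; `5 ∤ 7`, `5` inert in `K`), W. Zhang's level-one class, first sign `ν + 1 ≤ rank`
(`5³ ≤ 5^rank` from `three_le_rank`). The twist `E^{(-7)}` has EVEN analytic rank (odd rank `3`, Heegner `K`):
where `L(E^{(-7)}, 1) ≠ 0` the expected closing datum is `Sel_5(E^{(-7)}/ℚ) = 0`, a RANK-ZERO datum
(`cruxBody_of_twistSelmer_trivial_of_steinWuthrich`, part 1). CONDITIONAL on the two named facts and the one
twist datum; per curve (the open stub (S♭) is untouched); BSD is not proved by it.
[cite: SteinWuthrich2013, Thm. 1.1 (p. 1758)] [cite: WZhang2014, Lemma 8.4 (1) (p. 236), Thm. 9.1 (p. 240)]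
[cite: CremonaAlgorithms1997, Table 1 (16811a1)] -/
theorem cruxBody_of_twistSelmer
    (hSW : SteinWuthrich2013_sha_inf_torsionBy_eq_bot_of_two_le_rank)
    (h84 : Literature.NumberTheory.EllipticCurves.WZhang2014_lemma84_exists_minimal_kolyvaginClass_one_selmerCard)
    (K : Type) [Field K] [NumberField K] (hK : IsImaginaryQuadratic K)
    (hD : NumberField.discr K = -7)
    (hT : haveI := isElliptic_of_mem_atlasR3A00 mem_atlas;
      Nat.card (((c16811a1.e.baseChange ℚ).quadraticTwist (NumberField.discr K : ℚ)).selmerGroup (5 : ℕ)) ≤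
        5 ^ 3) :
    haveI := isElliptic_of_mem_atlasR3A00 mem_atlas;
    haveI := isGloballyMinimal_of_mem_atlasR3A00 mem_atlas;
    ∃ (p : ℕ) (hp : Fact p.Prime), 5 ≤ p ∧ (c16811a1.e.baseChange ℚ).HasGoodReductionAtPrime p ∧
      ¬ (p : ℤ) ∣ (c16811a1.e.baseChange ℚ).frobeniusTrace p ∧
      (∀ n : ℕ, (c16811a1.e.baseChange ℚ).HasSurjectiveModNGaloisRep (p ^ n : ℕ)) ∧
      (∀ v : HeightOneSpectrum (𝓞 ℚ), (c16811a1.e.baseChange ℚ).HasMultiplicativeReductionAt v →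
        ¬ p ∣ (c16811a1.e.baseChange ℚ).ordMinimalDiscriminant v) ∧
      ∃ (K : Type) (_ : Field K) (_ : NumberField K), IsImaginaryQuadratic K ∧
        NumberField.discr K ≠ -3 ∧ NumberField.discr K ≠ -4 ∧
        ∃ (_ : NeZero ((c16811a1.e.baseChange ℚ).conductorNorm ℤ)),
          SatisfiesHeegnerHypothesis ((c16811a1.e.baseChange ℚ).conductorNorm ℤ) K ∧
        ∃ (Dt : ModularParametrizationData (c16811a1.e.baseChange ℚ) ((c16811a1.e.baseChange ℚ).conductorNorm ℤ))
          (β : ℤ) (ι : K →+* ℂ) (n₁ : ℕ) (d : KolyvaginHeegnerData Dt β ι n₁), Squarefree n₁ ∧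
          (∀ q ∈ n₁.primeFactors,
            Zhang2014.IsKolyvaginPrime ((c16811a1.e.baseChange ℚ).conductorNorm ℤ) (c16811a1.e.baseChange ℚ) K p q) ∧
          d.kolyvaginClass hp.out 1 ≠ 0 ∧
          (n₁.primeFactors.card + 1 ≤ (c16811a1.e.baseChange ℚ).mordellWeilRank ∨
            (n₁.primeFactors.card ≤ (c16811a1.e.baseChange ℚ).mordellWeilRank ∧
              n₁.primeFactors.card + 1 ≤
                ((c16811a1.e.baseChange ℚ).quadraticTwist (NumberField.discr K : ℚ)).mordellWeilRank)) := by
  haveI := isElliptic_of_mem_atlasR3A00 mem_atlas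
  haveI := isGloballyMinimal_of_mem_atlasR3A00 mem_atlas
  haveI iNZ : NeZero ((c16811a1.e.baseChange ℚ).conductorNorm ℤ) := neZero_conductorNorm_of_isElliptic _
  haveI i5 := Fact.mk (by norm_num : Nat.Prime 5)
  have hsp := spade_5
  have hKN : ∀ v : HeightOneSpectrum (𝓞 ℚ), (c16811a1.e.baseChange ℚ).HasMultiplicativeReductionAt v →
      ¬ 5 ∣ (c16811a1.e.baseChange ℚ).ordMinimalDiscriminant v :=
    not_dvd_ordMinimalDiscriminant_of_intModel_table intModel (p := 5) (Δ₀ := -16811) (by decide +kernel)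
      (B := 8) (by decide +kernel) (by decide +kernel)
  have hS2 : ¬ Squarefree ((c16811a1.e.baseChange ℚ).conductorNorm ℤ) →
      (∃ (ℓ : ℕ) (_ : Fact ℓ.Prime), (c16811a1.e.baseChange ℚ).HasMultiplicativeReductionAtPrime ℓ ∧
          ¬ 5 ∣ padicValInt ℓ (c16811a1.e.baseChange ℚ).minimalDiscriminantInt) ∧
        ∃ (ℓ₁ ℓ₂ : ℕ) (_ : Fact ℓ₁.Prime) (_ : Fact ℓ₂.Prime), ℓ₁ ≠ ℓ₂ ∧
          (c16811a1.e.baseChange ℚ).HasMultiplicativeReductionAtPrime ℓ₁ ∧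
            (c16811a1.e.baseChange ℚ).HasMultiplicativeReductionAtPrime ℓ₂ :=
    fun hns ↦ absurd ((c16811a1.e.baseChange ℚ).isSemistable_iff_squarefree_conductorNorm.mp hsp.2) hns
  have hH := satisfiesHeegnerHypothesis_conductorNorm_of_intModel intModel K hK.1 hD heegner_neg7
  have hD3 : NumberField.discr K ≠ -3 := by rw [hD]; norm_num
  have hD4 : NumberField.discr K ≠ -4 := by rw [hD]; norm_num
  have hpD : ¬ (((5 : ℕ) : ℤ) ∣ NumberField.discr K) := by rw [hD]; norm_num
  have hr3 : 3 ≤ (c16811a1.e.baseChange ℚ).mordellWeilRank := three_le_rank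
  have hT' : Nat.card (((c16811a1.e.baseChange ℚ).quadraticTwist (NumberField.discr K : ℚ)).selmerGroup (5 : ℕ)) ≤
      5 ^ (c16811a1.e.baseChange ℚ).mordellWeilRank :=
    le_trans hT (Nat.pow_le_pow_right (by norm_num) hr3)
  exact cruxBody_of_twistSelmer_of_steinWuthrich hSW h84 _ not_hasCM (le_trans (by norm_num) hr3)
    (by rw [conductorNorm_eq]; norm_num) 5 (by norm_num) (by norm_num) goodOrdinary_5.1 goodOrdinary_5.2
    hasSurjectiveModNGaloisRep_pow_5 hKN hsp.1 hS2 K hK hD3 hD4 hpD hH hT'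


/-- **EXACT READING OF THE CRUX AT `16811a1`, `(p, d_K) = (5, -7)` — the `∃`-body ⟺ THE TWIST CONDITION ALONE.**
For `E = 16811a1` (rank `3`, ♠ cell, `5` admissible) and ANY imaginary quadratic `K` with `d_K = -7`: «∃ frame,
square-free product `n₁` of Kolyvagin primes, datum: `c_1(n₁) ≠ 0` ∧ the signed rank clause» (the body of
`KolyvaginDepthSupplyKN` at `(E, 5, K)`) `↔` «`#Sel_5(E^{(d_K)}/ℚ) ≤ 5^{rank E}` ∨ (`Ш(E^{(d_K)}/ℚ)[5] = 0` ∧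
`rank E^{(d_K)} = rank E + 1`)» — the lineage's exact reading on the ♠ cell
(`kolyvaginClass_rankClause_iff_shaTrivial_twistCondition_of_lemma84`, g14) with its `E`-side conjunct `Ш(E)[5] = 0`
DISCHARGED by Stein–Wuthrich Thm. 1.1 (`sha_inf_torsionBy_five_eq_bot`): at this odd-rank curve the crux's content
is a statement about ONE quadratic twist of even analytic rank and nothing else. CONDITIONAL on (γ), W. Zhang L8.4 (1) /
9.1 and SW Thm. 1.1 by name; per curve; BSD is not proved by it. [cite: SteinWuthrich2013, Thm. 1.1 (p. 1758)]
[cite: WZhang2014, Lemma 8.4 (1) (p. 236), Thm. 9.1 (p. 240)] [cite: GrossLMS1991, Prop. 3.7 (2)] [cite: SilvermanAEC2009, Thm. X.4.2] -/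
theorem exactBody_5_neg7_iff_twistCondition
    (hSW : SteinWuthrich2013_sha_inf_torsionBy_eq_bot_of_two_le_rank)
    (h372 : GrossLMS1991.prop37_2_frobeniusCongruence)
    (h84 : Literature.NumberTheory.EllipticCurves.WZhang2014_lemma84_exists_minimal_kolyvaginClass_one_selmerCard)
    (K : Type) [Field K] [NumberField K] (hK : IsImaginaryQuadratic K)
    (hD : NumberField.discr K = -7) :
    haveI := isElliptic_of_mem_atlasR3A00 mem_atlas;
    haveI := isGloballyMinimal_of_mem_atlasR3A00 mem_atlas;
    haveI : NeZero ((c16811a1.e.baseChange ℚ).conductorNorm ℤ) := neZero_conductorNorm_of_isElliptic _;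
    haveI := Fact.mk (by norm_num : Nat.Prime 5);
    (∃ (Dt : ModularParametrizationData (c16811a1.e.baseChange ℚ) ((c16811a1.e.baseChange ℚ).conductorNorm ℤ)) (β : ℤ) (ι : K →+* ℂ) (n₁ : ℕ)
      (d : KolyvaginHeegnerData Dt β ι n₁), Squarefree n₁ ∧
        (∀ q ∈ n₁.primeFactors, Zhang2014.IsKolyvaginPrime ((c16811a1.e.baseChange ℚ).conductorNorm ℤ) (c16811a1.e.baseChange ℚ) K 5 q) ∧
        d.kolyvaginClass (p := 5) (by norm_num) 1 ≠ 0 ∧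
        (n₁.primeFactors.card + 1 ≤ (c16811a1.e.baseChange ℚ).mordellWeilRank ∨
          (n₁.primeFactors.card ≤ (c16811a1.e.baseChange ℚ).mordellWeilRank ∧
            n₁.primeFactors.card + 1 ≤ ((c16811a1.e.baseChange ℚ).quadraticTwist (NumberField.discr K : ℚ)).mordellWeilRank))) ↔
    (Nat.card (((c16811a1.e.baseChange ℚ).quadraticTwist (NumberField.discr K : ℚ)).selmerGroup (5 : ℕ)) ≤ 5 ^ (c16811a1.e.baseChange ℚ).mordellWeilRank ∨
      ((((c16811a1.e.baseChange ℚ).quadraticTwist (NumberField.discr K : ℚ)).sha ⊓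
          AddSubgroup.torsionBy ((c16811a1.e.baseChange ℚ).quadraticTwist (NumberField.discr K : ℚ)).galH1 ((5 : ℕ) : ℤ) :
          AddSubgroup ((c16811a1.e.baseChange ℚ).quadraticTwist (NumberField.discr K : ℚ)).galH1) = ⊥ ∧
        ((c16811a1.e.baseChange ℚ).quadraticTwist (NumberField.discr K : ℚ)).mordellWeilRank = (c16811a1.e.baseChange ℚ).mordellWeilRank + 1)) := by
  haveI := isElliptic_of_mem_atlasR3A00 mem_atlas
  haveI := isGloballyMinimal_of_mem_atlasR3A00 mem_atlas
  haveI iNZ : NeZero ((c16811a1.e.baseChange ℚ).conductorNorm ℤ) := neZero_conductorNorm_of_isElliptic _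
  haveI i5 := Fact.mk (by norm_num : Nat.Prime 5)
  have hsp := spade_5
  have hKN : ∀ v : HeightOneSpectrum (𝓞 ℚ), (c16811a1.e.baseChange ℚ).HasMultiplicativeReductionAt v →
      ¬ 5 ∣ (c16811a1.e.baseChange ℚ).ordMinimalDiscriminant v :=
    not_dvd_ordMinimalDiscriminant_of_intModel_table intModel (p := 5) (Δ₀ := -16811) (by decide +kernel)
      (B := 8) (by decide +kernel) (by decide +kernel)
  have hS2 : ¬ Squarefree ((c16811a1.e.baseChange ℚ).conductorNorm ℤ) →
      (∃ (ℓ : ℕ) (_ : Fact ℓ.Prime), (c16811a1.e.baseChange ℚ).HasMultiplicativeReductionAtPrime ℓ ∧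
          ¬ 5 ∣ padicValInt ℓ (c16811a1.e.baseChange ℚ).minimalDiscriminantInt) ∧
        ∃ (ℓ₁ ℓ₂ : ℕ) (_ : Fact ℓ₁.Prime) (_ : Fact ℓ₂.Prime), ℓ₁ ≠ ℓ₂ ∧
          (c16811a1.e.baseChange ℚ).HasMultiplicativeReductionAtPrime ℓ₁ ∧
            (c16811a1.e.baseChange ℚ).HasMultiplicativeReductionAtPrime ℓ₂ :=
    fun hns ↦ absurd ((c16811a1.e.baseChange ℚ).isSemistable_iff_squarefree_conductorNorm.mp hsp.2) hns
  have hH := satisfiesHeegnerHypothesis_conductorNorm_of_intModel intModel K hK.1 hD heegner_neg7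
  have hD3 : NumberField.discr K ≠ -3 := by rw [hD]; norm_num
  have hD4 : NumberField.discr K ≠ -4 := by rw [hD]; norm_num
  have hpD : ¬ (((5 : ℕ) : ℤ) ∣ NumberField.discr K) := by rw [hD]; norm_num
  have hr3 : 3 ≤ (c16811a1.e.baseChange ℚ).mordellWeilRank := three_le_rank
  exact (kolyvaginClass_rankClause_iff_shaTrivial_twistCondition_of_lemma84 h372 h84 _ not_hasCM 5 (by norm_num)
    goodOrdinary_5.1 goodOrdinary_5.2 hasSurjectiveModNGaloisRep_pow_5 hKN hsp.1 hS2 K hK hD3 hD4 hpD hH).trans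
    (and_iff_right (sha_inf_torsionBy_five_eq_bot hSW))

/-- **DEPTH-TABLE ROW `16811a1`, `(p, d_K) = (5, -7)`, at depth `rank − 1`, v14 — «ONE BIT ⟺ ONE TWIST-SELMER BOUND».**
For `E = 16811a1` and ANY imaginary quadratic `K` with `d_K = -7`: «∃ frame, square-free product `n₁` of `rank E − 1`
Kolyvagin primes, datum: `c_1(n₁) ≠ 0`» `↔` «`#Sel_5(E^{(d_K)}/ℚ) ≤ 5^{rank E − 1}`» — the lineage's depth row on
the ♠ cell (`kolyvaginClass_depth_ne_zero_iff_shaTrivial_twistSelmer_of_lemma84`, g14) with `Ш(E)[5] = 0` DISCHARGED by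
SW Thm. 1.1. With `rank E = 3` (the tree holds `3 ≤ rank`) the bit a depth-`2` computation would find is EXACTLY
«`dim_𝔽₅ Sel_5(E^{(d_K)}) ≤ 2`»; for a twist of analytic rank `0` (no `5`-torsion: `E^{(d)}[5]` is irreducible)
that is «`#Ш(E^{(d_K)}/ℚ)[5] ≤ 25`». CONDITIONAL on (γ), W. Zhang L8.4 (1) / 9.1 and SW Thm. 1.1 by name; per curve;
BSD is not proved by it. [cite: SteinWuthrich2013, Thm. 1.1 (p. 1758)] [cite: WZhang2014, Lemma 8.4 (1) (p. 236)]
[cite: GrossLMS1991, Prop. 3.7 (2), §5 (5.1)] [cite: Kolyvagin1991MathAnn, Thm. 2.3] -/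
theorem exactRowDepth_5_neg7_iff_twistSelmer
    (hSW : SteinWuthrich2013_sha_inf_torsionBy_eq_bot_of_two_le_rank)
    (h372 : GrossLMS1991.prop37_2_frobeniusCongruence)
    (h84 : Literature.NumberTheory.EllipticCurves.WZhang2014_lemma84_exists_minimal_kolyvaginClass_one_selmerCard)
    (K : Type) [Field K] [NumberField K] (hK : IsImaginaryQuadratic K)
    (hD : NumberField.discr K = -7) :
    haveI := isElliptic_of_mem_atlasR3A00 mem_atlas;
    haveI := isGloballyMinimal_of_mem_atlasR3A00 mem_atlas;
    haveI : NeZero ((c16811a1.e.baseChange ℚ).conductorNorm ℤ) := neZero_conductorNorm_of_isElliptic _;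
    haveI := Fact.mk (by norm_num : Nat.Prime 5);
    (∃ (Dt : ModularParametrizationData (c16811a1.e.baseChange ℚ) ((c16811a1.e.baseChange ℚ).conductorNorm ℤ)) (β : ℤ) (ι : K →+* ℂ) (n₁ : ℕ)
      (d : KolyvaginHeegnerData Dt β ι n₁), Squarefree n₁ ∧
        (∀ q ∈ n₁.primeFactors, Zhang2014.IsKolyvaginPrime ((c16811a1.e.baseChange ℚ).conductorNorm ℤ) (c16811a1.e.baseChange ℚ) K 5 q) ∧
        n₁.primeFactors.card + 1 = (c16811a1.e.baseChange ℚ).mordellWeilRank ∧ d.kolyvaginClass (p := 5) (by norm_num) 1 ≠ 0) ↔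
    Nat.card (((c16811a1.e.baseChange ℚ).quadraticTwist (NumberField.discr K : ℚ)).selmerGroup (5 : ℕ)) ≤
      5 ^ ((c16811a1.e.baseChange ℚ).mordellWeilRank - 1) := by
  haveI := isElliptic_of_mem_atlasR3A00 mem_atlas
  haveI := isGloballyMinimal_of_mem_atlasR3A00 mem_atlas
  haveI iNZ : NeZero ((c16811a1.e.baseChange ℚ).conductorNorm ℤ) := neZero_conductorNorm_of_isElliptic _
  haveI i5 := Fact.mk (by norm_num : Nat.Prime 5)
  have hsp := spade_5
  have hKN : ∀ v : HeightOneSpectrum (𝓞 ℚ), (c16811a1.e.baseChange ℚ).HasMultiplicativeReductionAt v →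
      ¬ 5 ∣ (c16811a1.e.baseChange ℚ).ordMinimalDiscriminant v :=
    not_dvd_ordMinimalDiscriminant_of_intModel_table intModel (p := 5) (Δ₀ := -16811) (by decide +kernel)
      (B := 8) (by decide +kernel) (by decide +kernel)
  have hS2 : ¬ Squarefree ((c16811a1.e.baseChange ℚ).conductorNorm ℤ) →
      (∃ (ℓ : ℕ) (_ : Fact ℓ.Prime), (c16811a1.e.baseChange ℚ).HasMultiplicativeReductionAtPrime ℓ ∧
          ¬ 5 ∣ padicValInt ℓ (c16811a1.e.baseChange ℚ).minimalDiscriminantInt) ∧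
        ∃ (ℓ₁ ℓ₂ : ℕ) (_ : Fact ℓ₁.Prime) (_ : Fact ℓ₂.Prime), ℓ₁ ≠ ℓ₂ ∧
          (c16811a1.e.baseChange ℚ).HasMultiplicativeReductionAtPrime ℓ₁ ∧
            (c16811a1.e.baseChange ℚ).HasMultiplicativeReductionAtPrime ℓ₂ :=
    fun hns ↦ absurd ((c16811a1.e.baseChange ℚ).isSemistable_iff_squarefree_conductorNorm.mp hsp.2) hns
  have hH := satisfiesHeegnerHypothesis_conductorNorm_of_intModel intModel K hK.1 hD heegner_neg7
  have hD3 : NumberField.discr K ≠ -3 := by rw [hD]; norm_num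
  have hD4 : NumberField.discr K ≠ -4 := by rw [hD]; norm_num
  have hpD : ¬ (((5 : ℕ) : ℤ) ∣ NumberField.discr K) := by rw [hD]; norm_num
  have hr3 : 3 ≤ (c16811a1.e.baseChange ℚ).mordellWeilRank := three_le_rank
  exact (kolyvaginClass_depth_ne_zero_iff_shaTrivial_twistSelmer_of_lemma84 h372 h84 _ not_hasCM 5 (by norm_num)
    goodOrdinary_5.1 goodOrdinary_5.2 hasSurjectiveModNGaloisRep_pow_5 hKN hsp.1 hS2 K hK hD3 hD4 hpD hH
    (le_trans (by norm_num) hr3)).trans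
    (and_iff_right (sha_inf_torsionBy_five_eq_bot hSW))

end C16811a1

end Summit.BirchSwinnertonDyer.BirchSwinnertonDyer.Theorems.KolyvaginDepthDoor

end
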